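import Mathlib
import Literature.NumberTheory.Sieve.SingularSeries
import Summits.Parity.GeneralizedHardyLittlewood.Theorems.LiouvilleShiftedTablesPairsFromMAvgGrowth
import Summits.Parity.GeneralizedHardyLittlewood.Theorems.LiouvilleShiftedTablesPairsFromMAvg

/-!
# `EngineToGHL` (stmt-Parity-14995), line `tuple_ladder`, stub `stub_rungAssembly`

Crux `Summit.Parity.GeneralizedHardyLittlewood.Theses.LiouvilleMAD.EngineToGHL`, line `tuple_ladder`:
the ASSEMBLY of one rung of the tuple ladder.  Hardy–Littlewood for the tuple `H' ∪ {hs}`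
(`hs ∉ H'`) from four inputs: (H1) Hardy–Littlewood for `H'`; (H2) the relative tuple level of
distribution of `F(n) = ∏_{h ∈ H'} Λ(n+h)` at level `N^{1-δ}` (every `δ > 0`, every exponent `B`);
(H3) the singular-series identity `𝔖(H' ∪ {hs}) = 𝔖(H')·c` with `-∑_{d ≤ D} μ(d) log d w(d) → c`;
(H4) the large divisors `d > N^{1-δ}` of the opened factor `Λ(n+hs) = -∑_{d ∣ n+hs} μ(d) log d`
are `o(N)`.

Proof: `∏_{h ∈ H' ∪ {hs}} Λ(n+h) = Λ(n+hs) F(n)`, open `Λ(n+hs)`, split the divisors at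
`D = ⌊N^{1-δ}⌋₊`; the small divisors are exchanged (`d ∣ n + hs ↔ n ≡ d - hs % d (mod d)`) and
controlled by (H2) at `B = 2`, heights `y_d = N`, residues `r_d = d - hs % d`, giving
`|X(N) - g(D) S_{H'}(N)| ≤ C N / log N`; then (H1), (H3) (`D(N) → ∞`) and (H4) give the claim by
`o(N)`-algebra. [folklore]
-/

noncomputable section

open Finset Real ArithmeticFunction Filter Asymptotics
open scoped ArithmeticFunction.Moebius Topology

namespace Summit.Parity.GeneralizedHardyLittlewood.Theorems.EngineToGHL.TupleLadder

/-- Opening the new von Mangoldt factor and splitting its divisor sum at `D`: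
`∑_{n ≤ N} ∏_{h ∈ H' ∪ {hs}} Λ(n+h) = -∑_{d ≤ D} μ(d) log d A_d(N) - ∑_{n ≤ N} F(n) ∑_{d ∣ n+hs, d > D} μ(d) log d`,
`A_d(N) = ∑_{n ≤ N, d ∣ n + hs} F(n)`. [folklore] -/
theorem sum_prod_insert_eq (H' : Finset ℕ) {hs : ℕ} (hnot : hs ∉ H') (N D : ℕ) :
    ∑ n ∈ Icc 1 N, ∏ h ∈ insert hs H', Λ (n + h) =
      -(∑ d ∈ Icc 1 D, (μ d : ℝ) * Real.log d *
          ∑ n ∈ (Icc 1 N).filter (fun n : ℕ => d ∣ n + hs), ∏ h ∈ H', Λ (n + h)) -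
        ∑ n ∈ Icc 1 N, (∏ h ∈ H', Λ (n + h)) *
          ∑ d ∈ (n + hs).divisors.filter (fun d : ℕ => D < d), (μ d : ℝ) * Real.log d := by
  have hpt : ∀ n ∈ Icc 1 N, ∏ h ∈ insert hs H', Λ (n + h) =
      -((∏ h ∈ H', Λ (n + h)) * ∑ d ∈ (n + hs).divisors.filter (fun d : ℕ => ¬ D < d),
          (μ d : ℝ) * Real.log d) -
        (∏ h ∈ H', Λ (n + h)) * ∑ d ∈ (n + hs).divisors.filter (fun d : ℕ => D < d),
          (μ d : ℝ) * Real.log d := by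
    intro n _
    have hΛ : Λ (n + hs) = -((∑ d ∈ (n + hs).divisors.filter (fun d : ℕ => D < d),
        (μ d : ℝ) * Real.log d) + ∑ d ∈ (n + hs).divisors.filter (fun d : ℕ => ¬ D < d),
          (μ d : ℝ) * Real.log d) := by
      have h := sum_moebius_mul_log_eq (n := n + hs)
      simp only [ArithmeticFunction.log_apply] at h
      rw [Finset.sum_filter_add_sum_filter_not, h, neg_neg]
    rw [Finset.prod_insert hnot, hΛ]
    ring
  rw [Finset.sum_congr rfl hpt, Finset.sum_sub_distrib, Finset.sum_neg_distrib]
  congr 2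
  -- exchange the order of summation in the small-divisor part
  simp_rw [Finset.mul_sum]
  rw [Finset.sum_comm' (t' := Icc 1 D) (s' := fun d => (Icc 1 N).filter (fun n : ℕ => d ∣ n + hs))]
  · exact Finset.sum_congr rfl fun d _ => Finset.sum_congr rfl fun n _ => by ring
  · intro n d
    simp only [Finset.mem_filter, Finset.mem_Icc, Nat.mem_divisors, not_lt]
    constructor
    · rintro ⟨⟨h1, h2⟩, ⟨h3, -⟩, h5⟩
      exact ⟨⟨⟨h1, h2⟩, h3⟩, Nat.pos_of_dvd_of_pos h3 (by omega), h5⟩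
    · rintro ⟨⟨⟨h1, h2⟩, h3⟩, -, h5⟩
      exact ⟨⟨h1, h2⟩, ⟨h3, by omega⟩, h5⟩

/-- For `d ≥ 1`: `d ∣ n + hs ↔ n ≡ d - hs % d (mod d)`. [folklore] -/
theorem dvd_add_iff_modEq {d : ℕ} (hd : 0 < d) (n hs : ℕ) :
    d ∣ n + hs ↔ n ≡ d - hs % d [MOD d] := by
  have h1 : hs % d ≤ d := (Nat.mod_lt hs hd).le
  have hmod : n + hs % d ≡ n + hs [MOD d] := (Nat.ModEq.refl n).add (Nat.mod_modEq hs d)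
  have hdd : d ≡ 0 [MOD d] := Nat.modEq_zero_iff_dvd.mpr dvd_rfl
  rw [← Nat.modEq_zero_iff_dvd]
  constructor
  · intro h
    have h2 : n + hs % d ≡ d - hs % d + hs % d [MOD d] := by
      rw [Nat.sub_add_cancel h1]
      exact hmod.trans (h.trans hdd.symm)
    exact Nat.ModEq.add_right_cancel' (hs % d) h2
  · intro h
    have h2 : n + hs % d ≡ d [MOD d] := by
      have := h.add_right (hs % d)
      rwa [Nat.sub_add_cancel h1] at this
    exact (hmod.symm.trans h2).trans hdd

/-- The level step: with `D ≤ N`, `2 ≤ N`,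
`|∑_{d ≤ D} μ(d) log d A_d(N) - (∑_{d ≤ D} μ(d) log d w(d)) S(N)| ≤ log N · ∑_{d ≤ D} |A_d(N) - w(d) S(N)| ≤ C N / log N`
once the level bound `≤ C N/(log N)²` holds for the residues `r_d = d - hs % d`. [folklore] -/
theorem level_step (F w : ℕ → ℝ) (hs : ℕ) {D N : ℕ} (hDN : D ≤ N) (hN : 2 ≤ N) {C : ℝ}
    (hlev : ∑ d ∈ Icc 1 D, |(∑ n ∈ (Icc 1 N).filter (fun n : ℕ => n ≡ d - hs % d [MOD d]), F n) -
        w d * ∑ n ∈ Icc 1 N, F n| ≤ C * N / Real.log N ^ (2 : ℝ)) :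
    |∑ d ∈ Icc 1 D, (μ d : ℝ) * Real.log d * ∑ n ∈ (Icc 1 N).filter (fun n : ℕ => d ∣ n + hs), F n +
        (-∑ d ∈ Icc 1 D, (μ d : ℝ) * Real.log d * w d) * ∑ n ∈ Icc 1 N, F n| ≤
      C * ((N : ℝ) / Real.log N) := by
  have hlog : 0 < Real.log N := Real.log_pos (by exact_mod_cast hN)
  -- replace the congruence condition by the divisibility condition
  have hcongr : ∀ d ∈ Icc 1 D,
      |(∑ n ∈ (Icc 1 N).filter (fun n : ℕ => n ≡ d - hs % d [MOD d]), F n) - w d * ∑ n ∈ Icc 1 N, F n| =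
        |(∑ n ∈ (Icc 1 N).filter (fun n : ℕ => d ∣ n + hs), F n) - w d * ∑ n ∈ Icc 1 N, F n| := by
    intro d hd
    rw [Finset.filter_congr (fun n _ => (dvd_add_iff_modEq (Finset.mem_Icc.mp hd).1 n hs).symm)]
  rw [Finset.sum_congr rfl hcongr] at hlev
  -- termwise bound `|μ(d)| log d ≤ log N`
  have hmain : |∑ d ∈ Icc 1 D, (μ d : ℝ) * Real.log d *
        ∑ n ∈ (Icc 1 N).filter (fun n : ℕ => d ∣ n + hs), F n +
        (-∑ d ∈ Icc 1 D, (μ d : ℝ) * Real.log d * w d) * ∑ n ∈ Icc 1 N, F n| ≤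
      Real.log N * ∑ d ∈ Icc 1 D,
        |(∑ n ∈ (Icc 1 N).filter (fun n : ℕ => d ∣ n + hs), F n) - w d * ∑ n ∈ Icc 1 N, F n| := by
    rw [neg_mul, ← sub_eq_add_neg, Finset.sum_mul, ← Finset.sum_sub_distrib, Finset.mul_sum]
    refine (Finset.abs_sum_le_sum_abs _ _).trans (Finset.sum_le_sum fun d hd => ?_)
    rw [Finset.mem_Icc] at hd
    have h1 : (μ d : ℝ) * Real.log d * ∑ n ∈ (Icc 1 N).filter (fun n : ℕ => d ∣ n + hs), F n -
        (μ d : ℝ) * Real.log d * w d * ∑ n ∈ Icc 1 N, F n =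
        ((μ d : ℝ) * Real.log d) *
          ((∑ n ∈ (Icc 1 N).filter (fun n : ℕ => d ∣ n + hs), F n) - w d * ∑ n ∈ Icc 1 N, F n) := by
      ring
    rw [h1, abs_mul, abs_mul]
    refine mul_le_mul_of_nonneg_right ?_ (abs_nonneg _)
    have hμ : |(μ d : ℝ)| ≤ 1 := by exact_mod_cast ArithmeticFunction.abs_moebius_le_one
    have hd1 : (1 : ℝ) ≤ d := by exact_mod_cast hd.1
    have hlog0 : 0 ≤ Real.log d := Real.log_nonneg hd1
    have hlogN : Real.log d ≤ Real.log N :=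
      Real.log_le_log (by linarith) (by exact_mod_cast hd.2.trans hDN)
    rw [abs_of_nonneg hlog0]
    calc |(μ d : ℝ)| * Real.log d ≤ 1 * Real.log d := mul_le_mul_of_nonneg_right hμ hlog0
      _ ≤ Real.log N := by rw [one_mul]; exact hlogN
  refine hmain.trans ((mul_le_mul_of_nonneg_left hlev hlog.le).trans (le_of_eq ?_))
  rw [Real.rpow_two]
  field_simp

/-- An `ε`–`N₀` bound `|Y(N)| ≤ ε N` for every `ε > 0` is `Y = o(N)`. [folklore] -/
theorem isLittleO_of_forall_eps {Y : ℕ → ℝ}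
    (hY : ∀ ε : ℝ, 0 < ε → ∃ N₀ : ℕ, ∀ N : ℕ, N₀ ≤ N → |Y N| ≤ ε * N) :
    Y =o[atTop] fun N : ℕ => (N : ℝ) := by
  refine Asymptotics.isLittleO_iff.mpr fun ε hε => ?_
  obtain ⟨N₀, hN₀⟩ := hY ε hε
  filter_upwards [eventually_ge_atTop N₀] with N hN
  rw [Real.norm_eq_abs, Real.norm_eq_abs, Nat.abs_cast]
  exact hN₀ N hN

/-- The `o(N)`-algebra of the rung: from `T = -X - Y`, `|X + g S| ≤ C N/log N` eventually,
`S - 𝔖' N = o(N)`, `𝔖 = 𝔖' c`, `g → c` and `Y = o(N)`, conclude `T - 𝔖 N = o(N)` via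
`T - 𝔖 N = -(X + g S) + g (S - 𝔖' N) + N (g - c) 𝔖' - Y`. [folklore] -/
theorem isLittleO_assembly {T S X Y g : ℕ → ℝ} {𝔖 𝔖' c C : ℝ}
    (hT : ∀ N, T N = -X N - Y N)
    (hX : ∀ᶠ N : ℕ in atTop, |X N + g N * S N| ≤ C * ((N : ℝ) / Real.log N))
    (hS : (fun N : ℕ => S N - 𝔖' * N) =o[atTop] fun N : ℕ => (N : ℝ))
    (h𝔖 : 𝔖 = 𝔖' * c) (hg : Tendsto g atTop (𝓝 c))
    (hY : Y =o[atTop] fun N : ℕ => (N : ℝ)) :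
    (fun N : ℕ => T N - 𝔖 * N) =o[atTop] fun N : ℕ => (N : ℝ) := by
  have hident : ∀ N : ℕ, T N - 𝔖 * N =
      -(X N + g N * S N) + g N * (S N - 𝔖' * N) + (N : ℝ) * ((g N - c) * 𝔖') - Y N := by
    intro N; rw [hT N, h𝔖]; ring
  have h1 : (fun N : ℕ => -(X N + g N * S N)) =o[atTop] fun N : ℕ => (N : ℝ) := by
    refine PairsFromMAvg.isLittleO_of_le_mul_div_log C ?_
    filter_upwards [hX] with N hN
    rwa [abs_neg]
  have h2 : (fun N : ℕ => g N * (S N - 𝔖' * N)) =o[atTop] fun N : ℕ => (N : ℝ) := by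
    have hgO : g =O[atTop] (fun _ : ℕ => (1 : ℝ)) := hg.isBigO_one ℝ
    simpa only [one_mul] using hgO.mul_isLittleO hS
  have h3 : (fun N : ℕ => (N : ℝ) * ((g N - c) * 𝔖')) =o[atTop] fun N : ℕ => (N : ℝ) := by
    refine PairsFromMAvg.isLittleO_mul_of_tendsto_zero ?_
    have := (hg.sub_const c).mul_const 𝔖'
    simpa only [sub_self, zero_mul] using this
  exact (((h1.add h2).add h3).sub hY).congr' (Eventually.of_forall fun N => (hident N).symm)
    EventuallyEq.rfl

/-- **stub_rungAssembly.** The rung of the tuple ladder assembled from its pieces: with `hs ∉ H'`,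
Hardy–Littlewood for `H'` (H1), the relative tuple level of distribution of `∏_{h ∈ H'} Λ(n+h)` (H2),
the singular-series identity with its limit (H3) and the negligibility of the large divisors of the
opened factor `Λ(n+hs)` (H4) give Hardy–Littlewood for `H' ∪ {hs}`. [folklore] -/
theorem stub_rungAssembly : ∀ (H' : Finset ℕ) (hs : ℕ), hs ∉ H' → ((fun N : ℕ => ∑ n ∈ Finset.Icc 1 N, ∏ h ∈ H', ArithmeticFunction.vonMangoldt (n + h) - Literature.NumberTheory.Sieve.singularSeries ((H').image (fun h : ℕ => (h : ℤ))) * N) =o[Filter.atTop] fun N : ℕ => (N : ℝ)) → (∀ δ : ℝ, 0 < δ → ∀ B : ℝ, ∃ C : ℝ, ∀ N : ℕ, 2 ≤ N → ∀ y r : ℕ → ℕ, (∀ d, y d ≤ N) → (∑ d ∈ Finset.Icc 1 ⌊(N : ℝ) ^ (1 - δ)⌋₊, |(∑ n ∈ (Finset.Icc 1 (y d)).filter (fun n : ℕ => n ≡ r d [MOD d]), ∏ h ∈ H', ArithmeticFunction.vonMangoldt (n + h)) - (if ∀ h ∈ H', Nat.Coprime (r d + h) d then (((Finset.range d).filter (fun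 ρ : ℕ => ∀ h ∈ H', Nat.Coprime (ρ + h) d)).card : ℝ)⁻¹ else 0) * ∑ n ∈ Finset.Icc 1 (y d), ∏ h ∈ H', ArithmeticFunction.vonMangoldt (n + h)|) ≤ C * N / Real.log N ^ B) → (∃ c : ℝ, Literature.NumberTheory.Sieve.singularSeries ((insert hs H').image (fun h : ℕ => (h : ℤ))) = Literature.NumberTheory.Sieve.singularSeries ((H').image (fun h : ℕ => (h : ℤ))) * c ∧ Filter.Tendsto (fun D : ℕ => -∑ d ∈ Finset.Icc 1 D, (ArithmeticFunction.moebius d : ℝ) * Real.log d * (if ∀ h ∈ H', Nat.Coprime (d - hs % d + h) d then (((Finset.range d).filter (fun ρ : ℕ => ∀ h ∈ H', Nat.Coprime (ρ + h) d)).card : ℝ)⁻¹ else 0)) Filter.atTop (nhds c)) → (∃ δ : ℝ, 0 < δ ∧ δ < 1 ∧ ∀ ε : ℝ, 0 < ε → ∃ N₀ : ℕ, ∀ N : ℕ, N₀ ≤ N → |∑ n ∈ Finset.Icc 1 N, (∏ h ∈ H', ArithmeticFunction.vonMangoldt (n + h)) * ∑ d ∈ (n + hs).divisors.filter (fun d :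 ℕ => ⌊(N : ℝ) ^ (1 - δ)⌋₊ < d), (ArithmeticFunction.moebius d : ℝ) * Real.log d| ≤ ε * N) → ((fun N : ℕ => ∑ n ∈ Finset.Icc 1 N, ∏ h ∈ insert hs H', ArithmeticFunction.vonMangoldt (n + h) - Literature.NumberTheory.Sieve.singularSeries ((insert hs H').image (fun h : ℕ => (h : ℤ))) * N) =o[Filter.atTop] fun N : ℕ => (N : ℝ)) := by
  intro H' hs hnot hHL hLev hSS hLarge
  obtain ⟨c, h𝔖c, hT⟩ := hSS
  obtain ⟨δ, hδ0, hδ1, hY⟩ := hLarge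
  obtain ⟨C, hC⟩ := hLev δ hδ0 2
  -- `D(N) = ⌊N^{1-δ}⌋₊ → ∞`
  have hD : Tendsto (fun N : ℕ => ⌊(N : ℝ) ^ (1 - δ)⌋₊) atTop atTop :=
    tendsto_nat_floor_atTop.comp ((tendsto_rpow_atTop (by linarith)).comp tendsto_natCast_atTop_atTop)
  refine isLittleO_assembly
    (T := fun N : ℕ => ∑ n ∈ Icc 1 N, ∏ h ∈ insert hs H', Λ (n + h))
    (S := fun N : ℕ => ∑ n ∈ Icc 1 N, ∏ h ∈ H', Λ (n + h))
    (X := fun N : ℕ => ∑ d ∈ Icc 1 ⌊(N : ℝ) ^ (1 - δ)⌋₊, (μ d : ℝ) * Real.log d *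
      ∑ n ∈ (Icc 1 N).filter (fun n : ℕ => d ∣ n + hs), ∏ h ∈ H', Λ (n + h))
    (Y := fun N : ℕ => ∑ n ∈ Icc 1 N, (∏ h ∈ H', Λ (n + h)) *
      ∑ d ∈ (n + hs).divisors.filter (fun d : ℕ => ⌊(N : ℝ) ^ (1 - δ)⌋₊ < d), (μ d : ℝ) * Real.log d)
    (g := fun N : ℕ => -∑ d ∈ Icc 1 ⌊(N : ℝ) ^ (1 - δ)⌋₊, (μ d : ℝ) * Real.log d *
      (if ∀ h ∈ H', Nat.Coprime (d - hs % d + h) d then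
        (((Finset.range d).filter (fun ρ : ℕ => ∀ h ∈ H', Nat.Coprime (ρ + h) d)).card : ℝ)⁻¹ else 0))
    (C := C) (fun N => sum_prod_insert_eq H' hnot N _) ?_ hHL h𝔖c (hT.comp hD)
    (isLittleO_of_forall_eps hY)
  -- the level step, eventually
  filter_upwards [eventually_ge_atTop 2] with N hN2
  have hDN : ⌊(N : ℝ) ^ (1 - δ)⌋₊ ≤ N := PairsFromMAvg.floor_rpow_le_self (by linarith) (by linarith) N
  exact level_step (fun n : ℕ => ∏ h ∈ H', Λ (n + h)) _ hs hDN hN2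
    (hC N hN2 (fun _ => N) (fun d => d - hs % d) (fun _ => le_rfl))

end Summit.Parity.GeneralizedHardyLittlewood.Theorems.EngineToGHL.TupleLadder

end
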